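import Mathlib
import HarnessLib
import Summits.NavierStokesRegularity.NavierStokesRegularity.Theorems.WakeRatchetMinimalViscousBlowupSupLevelBootstrap

/-!
# Route `WakeRatchet`, crux `MinimalViscousBlowup` (stmt-NavierStokesRegularity-22743) — LINE g12-2 (ns-idea-1 g12, card «monotone quantity hunt»):
# RE-IGNITION, part 1/5 — bond flux under two level bounds, and the SINGLE-SHELL FENCE

ns-idea-1 g12's kernel-checked file `lines/g12-2/Reignition.lean` (sha16 d946145192243467, 872 l.; evidence on ⟨22743⟩), landed VERBATIM by the
hand ns-qj-p1 g7 in five tree-sized files (decl texts byte-identical; only the module docstrings are split):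
`…ShellFence` (§1–§2) · `…UpperBlock` (§3) · `…Reignition` (§4) · `…LevelGrowth` (§5) · `…RetreatDepth` (§6).
MODEL lattice only (Tao's NS-scaled `ν`-viscous cascade lattice, `m = 4`; nothing about Navier–Stokes; no NS regularity statement is proved).
`--supports stmt-NavierStokesRegularity-22743 --as helper`.

* `abs_botSum_le_of_two_levels` — if shell `n` has level `≤ V` and shell `n+1` level `≤ W`, then `|Π_n| ≤ 64·V·√W·λⁿ`;
* `shell_fence` — one shell `n+1` is fenced at level `F` on a window as soon as its lower neighbour stays at level `≤ V` with `16384 V² ≤ ν² F`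
  and its upper neighbour stays `≤ L₁ < ν²/16384` (inflow `Π_n ≤ 64 V √F λⁿ` loses to dissipation − outflow `≥ (ν − 64√L₁) F λ^{n+1}`).
[cite: Tao2016AveragedNS, §4 (4.1)–(4.3), Lemma 4.1 (4.5), §5; BarbatoMorandinRomito2011, §3.1]
-/

noncomputable section

set_option linter.dupNamespace false

open Set Filter Topology
open Literature.Analysis.FluidPDE Literature.Analysis.FluidPDE.TaoCascade

namespace Summit.NavierStokesRegularity.NavierStokesRegularity.Theorems.MinimalViscousBlowup.ThresholdRay

/-! ### §1 Bond flux under two level bounds -/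

/-- **Bond flux under two level bounds.**  If shell `n` has level `≤ V` and shell `n+1` has level `≤ W`, then `|Π_n| ≤ 64·V·√W·λⁿ`
(`|Π_n| ≤ 4³λ^{5n/2}‖X_n‖²‖X_{n+1}‖`). [cite: Tao2016AveragedNS, §4 (4.1)–(4.2)] -/
theorem abs_botSum_le_of_two_levels {ε₀ V W : ℝ} (hε : 0 < ε₀) (hV : 0 ≤ V) (hW : 0 ≤ W)
    {α : Fin 4 → Fin 4 → Fin 4 → ℤ × ℤ × ℤ → ℝ}
    (hα1 : ∀ i₁ i₂ i₃, |α i₁ i₂ i₃ (0, 0, 1)| ≤ 1) (X : Fin 4 → ℤ → ℝ → ℝ) {n : ℕ} {t : ℝ}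
    (hn : (1 + ε₀) ^ n * ‖shellVec X n t‖ ^ 2 ≤ V)
    (hn1 : (1 + ε₀) ^ (n + 1) * ‖shellVec X ((n + 1 : ℕ) : ℤ) t‖ ^ 2 ≤ W) :
    |botSum ε₀ α X n t| ≤ 64 * V * Real.sqrt W * (1 + ε₀) ^ n := by
  have hl0 : (0 : ℝ) < 1 + ε₀ := by linarith
  have hl1 : (1 : ℝ) ≤ 1 + ε₀ := by linarith
  have h1 : ‖shellVec X n t‖ ^ 2 ≤ V * ((1 + ε₀)⁻¹) ^ n := normSq_le_of_level hl0 hn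
  have h2 : ‖shellVec X ((n : ℤ) + 1) t‖ ≤ Real.sqrt W * Real.sqrt ((1 + ε₀)⁻¹) ^ (n + 1) := by
    have := norm_le_of_level hl0 hW hn1
    push_cast at this
    exact this
  have hb := abs_botSum_le_norm_shellVec hl0 hα1 X (n : ℤ) t
  have hWt := rpow_five_half_eq_sqrt_pow hl0 n
  set s : ℝ := Real.sqrt (1 + ε₀) with hs
  set ρ : ℝ := Real.sqrt ((1 + ε₀)⁻¹) with hρ
  set r : ℝ := (1 + ε₀)⁻¹ with hr
  have hs0 : 0 ≤ s := by rw [hs]; exact Real.sqrt_nonneg _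
  have hρ0 : 0 ≤ ρ := by rw [hρ]; exact Real.sqrt_nonneg _
  have hρ1 : ρ ≤ 1 := by
    rw [hρ, hr]; exact Real.sqrt_le_one.mpr (inv_le_one_of_one_le₀ hl1)
  have hss : s ^ 2 = 1 + ε₀ := by rw [hs]; exact Real.sq_sqrt hl0.le
  have hr0 : 0 ≤ r := by rw [hr]; exact inv_nonneg.2 hl0.le
  have hρρ : ρ ^ 2 = r := by rw [hρ]; exact Real.sq_sqrt (by rw [hr]; exact inv_nonneg.2 hl0.le)
  have hsρ : s * ρ = 1 := by
    rw [hs, hρ, ← Real.sqrt_mul hl0.le, hr, mul_inv_cancel₀ hl0.ne', Real.sqrt_one]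
  have hWs : 0 ≤ Real.sqrt W := Real.sqrt_nonneg _
  clear_value s ρ r
  have hweight : s ^ (5 * n) * r ^ n * ρ ^ (n + 1) = (1 + ε₀) ^ n * ρ := by
    have : s ^ (5 * n) * r ^ n * ρ ^ (n + 1) = (s ^ 2 * (s * ρ) ^ 3) ^ n * ρ := by rw [← hρρ]; ring
    rw [this, hsρ, one_pow, mul_one, hss]
  calc |botSum ε₀ α X n t|
      ≤ (4 : ℝ) ^ 3 * (1 + ε₀) ^ ((5 : ℝ) * ((n : ℕ) : ℤ) / 2) * ‖shellVec X n t‖ ^ 2 *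
          ‖shellVec X ((n : ℤ) + 1) t‖ := by exact_mod_cast hb
    _ ≤ (4 : ℝ) ^ 3 * s ^ (5 * n) * (V * r ^ n) * (Real.sqrt W * ρ ^ (n + 1)) := by
        rw [hWt]
        exact mul_le_mul (mul_le_mul_of_nonneg_left h1 (by positivity)) h2 (norm_nonneg _) (by positivity)
    _ = 64 * V * Real.sqrt W * (s ^ (5 * n) * r ^ n * ρ ^ (n + 1)) := by ring
    _ = 64 * V * Real.sqrt W * (1 + ε₀) ^ n * ρ := by rw [hweight]; ring
    _ ≤ 64 * V * Real.sqrt W * (1 + ε₀) ^ n := mul_le_of_le_one_right (by positivity) hρ1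

/-! ### §2 The single-shell fence -/

/-- **Single-shell fence.**  `λ = 1+ε₀`, `ν > 0`, cancelling table with `|α_{··(0,0,1)}| ≤ 1`, a trajectory solving the `ν`-viscous lattice
within `[0,T']`, a window `[t₀,x] ⊂ [0,T')`.  If on the window the lower neighbour `n` stays at level `≤ V`, the upper neighbour `n+2` at level
`≤ L₁ < ν²/16384`, and `16384 V² ≤ ν² F`, then shell `n+1`, at level `≤ F` at `t₀`, stays at level `≤ F` on the window: at the fence
`(F+η)λ^{−(n+1)}` the inflow `Π_n ≤ 64V√(F+η)λⁿ < (ν/2)(F+η)λⁿ` loses to dissipation − outflow `≥ (ν − 64√L₁)(F+η)λ^{n+1}`.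
[cite: Tao2016AveragedNS, §4 (4.1)–(4.3); BarbatoMorandinRomito2011, §3.1] -/
theorem shell_fence {ε₀ ν T' V L₁ F t₀ x : ℝ} (hε : 0 < ε₀) (hν : 0 < ν)
    {α : Fin 4 → Fin 4 → Fin 4 → ℤ × ℤ × ℤ → ℝ} (hcan : IsCancellingCoeff α)
    (hα1 : ∀ i₁ i₂ i₃, |α i₁ i₂ i₃ (0, 0, 1)| ≤ 1) {X : Fin 4 → ℤ → ℝ → ℝ}
    (hder : ∀ (i : Fin 4) (k : ℤ), ∀ t ∈ Icc 0 T', HasDerivWithinAt (X i k)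
      (quadTerm ε₀ α X i k t - ν * (1 + ε₀) ^ ((2 : ℝ) * k) * X i k t) (Icc 0 T') t)
    (ht₀ : 0 ≤ t₀) (hxT' : x < T') {n : ℕ}
    (hV : 0 ≤ V) (hL₁0 : 0 ≤ L₁) (hL₁ : L₁ < ν ^ 2 / 16384) (hF : 16384 * V ^ 2 ≤ ν ^ 2 * F)
    (hlo : ∀ τ ∈ Icc t₀ x, (1 + ε₀) ^ n * ‖shellVec X n τ‖ ^ 2 ≤ V)
    (hup : ∀ τ ∈ Icc t₀ x, (1 + ε₀) ^ (n + 2) * ‖shellVec X ((n + 2 : ℕ) : ℤ) τ‖ ^ 2 ≤ L₁)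
    (h0 : (1 + ε₀) ^ (n + 1) * ‖shellVec X ((n + 1 : ℕ) : ℤ) t₀‖ ^ 2 ≤ F) :
    ∀ τ ∈ Icc t₀ x, (1 + ε₀) ^ (n + 1) * ‖shellVec X ((n + 1 : ℕ) : ℤ) τ‖ ^ 2 ≤ F := by
  intro τ hτ
  have hl0 : (0 : ℝ) < 1 + ε₀ := by linarith
  have hl1 : (1 : ℝ) < 1 + ε₀ := by linarith
  have hF0 : 0 ≤ F := by
    by_contra h
    push Not at h
    nlinarith [sq_nonneg V, mul_neg_of_pos_of_neg (pow_pos hν 2) h]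
  set σ : ℝ := Real.sqrt L₁ with hσ
  have hσ0 : 0 ≤ σ := by rw [hσ]; exact Real.sqrt_nonneg _
  have hσν : 128 * σ < ν := by
    have h2 : Real.sqrt (ν ^ 2 / 16384) = ν / 128 := by
      rw [show ν ^ 2 / 16384 = (ν / 128) ^ 2 by ring, Real.sqrt_sq (by positivity)]
    have h1 : σ < ν / 128 := by rw [hσ, ← h2]; exact Real.sqrt_lt_sqrt hL₁0 hL₁
    linarith
  set r : ℝ := (1 + ε₀)⁻¹ with hr
  have hr0 : 0 < r := by rw [hr]; exact inv_pos.2 hl0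
  have hr1 : r ≤ 1 := by rw [hr]; exact inv_le_one_of_one_le₀ hl1.le
  have hPr : ∀ k : ℕ, (1 + ε₀) ^ k * r ^ k = 1 := fun k => by
    rw [hr, inv_pow, mul_inv_cancel₀ (pow_ne_zero _ hl0.ne')]
  clear_value σ r
  refine le_of_forall_pos_le_add fun η hη => ?_
  have hFη : 0 < F + η := by linarith
  -- `S = √(F+η)` and the key inequality `128 V < ν S`
  set S : ℝ := Real.sqrt (F + η) with hS
  have hS0 : 0 < S := by rw [hS]; exact Real.sqrt_pos.2 hFη
  have hS2 : S ^ 2 = F + η := by rw [hS]; exact Real.sq_sqrt hFη.le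
  clear_value S
  have hkey : 128 * V < ν * S := by
    have h1 : (128 * V) ^ 2 < (ν * S) ^ 2 := by
      rw [mul_pow, mul_pow, hS2]; nlinarith [pow_pos hν 2]
    exact lt_of_pow_lt_pow_left₀ 2 (by positivity) h1
  -- the shell-`(n+1)` energy and its derivative
  obtain ⟨Fn, hFn⟩ : ∃ Fn : ℝ → ℝ,
      Fn = fun w => ∑ k ∈ Finset.Ico (n + 1) (n + 1 + 1), ∑ i : Fin 4, (1 / 2 : ℝ) * X i k w ^ 2 := ⟨_, rfl⟩
  have hFeq : ∀ w, Fn w = 1 / 2 * ‖shellVec X ((n + 1 : ℕ) : ℤ) w‖ ^ 2 := by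
    intro w
    rw [hFn]
    simp only [Nat.Ico_succ_singleton, Finset.sum_singleton]
    rw [norm_shellVec_sq, Finset.mul_sum]
  obtain ⟨Fn', hFn'⟩ : ∃ Fn' : ℝ → ℝ, Fn' = fun w => botSum ε₀ α X (((n + 1 : ℕ) : ℤ) - 1) w -
      botSum ε₀ α X (((n + 1 + 1 : ℕ) : ℤ) - 1) w -
      ν * ∑ k ∈ Finset.Ico (n + 1) (n + 1 + 1), (1 + ε₀) ^ ((2 : ℝ) * (k : ℤ)) * ∑ i : Fin 4, X i k w ^ 2 := ⟨_, rfl⟩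
  have hF'eq : ∀ w, Fn' w = botSum ε₀ α X n w - botSum ε₀ α X ((n + 1 : ℕ) : ℤ) w -
      ν * (1 + ε₀) ^ (2 * (n + 1)) * ‖shellVec X ((n + 1 : ℕ) : ℤ) w‖ ^ 2 := by
    intro w
    rw [hFn']
    simp only [Nat.Ico_succ_singleton, Finset.sum_singleton]
    have hidx1 : (((n + 1 : ℕ) : ℤ) - 1) = (n : ℤ) := by push_cast; ring
    have hidx2 : (((n + 1 + 1 : ℕ) : ℤ) - 1) = ((n + 1 : ℕ) : ℤ) := by push_cast; ring
    have hw2 : (1 + ε₀) ^ ((2 : ℝ) * ((n + 1 : ℕ) : ℤ)) = (1 + ε₀) ^ (2 * (n + 1)) := by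
      rw [show (2 : ℝ) * (((n + 1 : ℕ) : ℤ) : ℝ) = ((2 * (n + 1) : ℕ) : ℝ) by push_cast; ring, Real.rpow_natCast]
    rw [hidx1, hidx2, hw2, norm_shellVec_sq]
    ring
  -- continuity and the derivative on the window
  have hXc : ∀ (i : Fin 4) (k : ℤ), ContinuousOn (X i k) (Icc t₀ x) := fun i k w hw =>
    ((hder i k w ⟨ht₀.trans hw.1, hw.2.trans hxT'.le⟩).continuousWithinAt).mono (Icc_subset_Icc ht₀ hxT'.le)
  have hFc : ContinuousOn Fn (Icc t₀ x) := by
    rw [hFn]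
    exact continuousOn_finsetSum _ fun k _ => continuousOn_finsetSum _ fun i _ =>
      continuousOn_const.mul ((hXc i k).pow 2)
  have hFder : ∀ w ∈ Ico t₀ x, HasDerivWithinAt Fn (Fn' w) (Ici w) w := by
    intro w hw
    have hw0 : 0 ≤ w := ht₀.trans hw.1
    have hwT' : w < T' := hw.2.trans hxT'
    have h := hasDerivWithinAt_blockEnergy (ε₀ := ε₀) (ν := ν) hcan (fun i k => hder i k w ⟨hw0, hwT'.le⟩)
      (Nat.le_succ (n + 1))
    rw [hFn, hFn']
    exact h.mono_of_mem_nhdsWithin (mem_of_superset (Icc_mem_nhdsGE hwT') (Icc_subset_Icc hw0 le_rfl))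
  -- the fence `Bc = (F+η) λ^{-(n+1)} / 2`
  obtain ⟨Bc, hBc⟩ : ∃ Bc : ℝ, Bc = (F + η) * r ^ (n + 1) / 2 := ⟨_, rfl⟩
  have hstart : Fn t₀ ≤ Bc := by
    rw [hFeq, hBc]
    have h1 := normSq_le_of_level hl0 h0
    rw [← hr] at h1
    have h2 : F * r ^ (n + 1) ≤ (F + η) * r ^ (n + 1) :=
      mul_le_mul_of_nonneg_right (by linarith) (pow_nonneg hr0.le _)
    linarith
  have hbound : ∀ w ∈ Ico t₀ x, Fn w = Bc → Fn' w < 0 := by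
    intro w hw hFw
    have hwI : w ∈ Icc t₀ x := Ico_subset_Icc_self hw
    have hy : ‖shellVec X ((n + 1 : ℕ) : ℤ) w‖ ^ 2 = (F + η) * r ^ (n + 1) := by
      have := hFeq w
      rw [hFw, hBc] at this
      linarith
    have hlev1 : (1 + ε₀) ^ (n + 1) * ‖shellVec X ((n + 1 : ℕ) : ℤ) w‖ ^ 2 ≤ F + η := by
      rw [hy, show (1 + ε₀) ^ (n + 1) * ((F + η) * r ^ (n + 1)) = (F + η) * ((1 + ε₀) ^ (n + 1) * r ^ (n + 1)) by ring,
        hPr, mul_one]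
    -- inflow `Π_n ≤ 64 V S λ^n`
    have hin : botSum ε₀ α X n w ≤ 64 * V * S * (1 + ε₀) ^ n := by
      have hb := abs_botSum_le_of_two_levels hε hV hFη.le hα1 X (hlo w hwI) hlev1
      rw [← hS] at hb
      linarith [le_abs_self (botSum ε₀ α X n w)]
    -- outflow `−Π_{n+1} ≤ 64 σ (F+η) λ^{n+1}`
    have hout : -botSum ε₀ α X ((n + 1 : ℕ) : ℤ) w ≤ 64 * σ * ((F + η) * (1 + ε₀) ^ (n + 1)) := by
      have hb := abs_botSum_le_of_level_succ hε hL₁0 hα1 X (n := n + 1) (by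
        have := hup w hwI
        exact this)
      rw [← hσ, hy] at hb
      have hQ : 64 * σ * (1 + ε₀) ^ (2 * (n + 1)) * ((F + η) * r ^ (n + 1)) =
          64 * σ * ((F + η) * (1 + ε₀) ^ (n + 1)) := by
        calc 64 * σ * (1 + ε₀) ^ (2 * (n + 1)) * ((F + η) * r ^ (n + 1))
            = 64 * σ * ((F + η) * (1 + ε₀) ^ (n + 1)) * ((1 + ε₀) ^ (n + 1) * r ^ (n + 1)) := by
              rw [two_mul, pow_add]; ring
          _ = 64 * σ * ((F + η) * (1 + ε₀) ^ (n + 1)) := by rw [hPr (n + 1), mul_one]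
      linarith [neg_abs_le (botSum ε₀ α X ((n + 1 : ℕ) : ℤ) w)]
    -- dissipation at the fence
    have hdis : ν * (1 + ε₀) ^ (2 * (n + 1)) * ‖shellVec X ((n + 1 : ℕ) : ℤ) w‖ ^ 2 =
        ν * ((F + η) * (1 + ε₀) ^ (n + 1)) := by
      rw [hy]
      calc ν * (1 + ε₀) ^ (2 * (n + 1)) * ((F + η) * r ^ (n + 1))
          = ν * ((F + η) * (1 + ε₀) ^ (n + 1)) * ((1 + ε₀) ^ (n + 1) * r ^ (n + 1)) := by
            rw [two_mul, pow_add]; ring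
        _ = ν * ((F + η) * (1 + ε₀) ^ (n + 1)) := by rw [hPr (n + 1), mul_one]
    -- the bracket is negative
    have hP : 0 < (1 + ε₀) ^ n := pow_pos hl0 n
    have hPP : (1 + ε₀) ^ n ≤ (1 + ε₀) ^ (n + 1) := pow_le_pow_right₀ hl1.le (Nat.le_succ n)
    have e1 : 64 * V * S ≤ ν / 2 * (F + η) := by
      rw [← hS2]; nlinarith [hkey, hS0]
    have e2 : 64 * V * S * (1 + ε₀) ^ n ≤ ν / 2 * (F + η) * (1 + ε₀) ^ (n + 1) := by
      calc 64 * V * S * (1 + ε₀) ^ n ≤ ν / 2 * (F + η) * (1 + ε₀) ^ n :=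
            mul_le_mul_of_nonneg_right e1 hP.le
        _ ≤ ν / 2 * (F + η) * (1 + ε₀) ^ (n + 1) :=
            mul_le_mul_of_nonneg_left hPP (by positivity)
    have e3 : (64 * σ - ν / 2) * ((F + η) * (1 + ε₀) ^ (n + 1)) < 0 :=
      mul_neg_of_neg_of_pos (by linarith) (by positivity)
    rw [hF'eq, hdis]
    nlinarith [hin, hout, e2, e3]
  have hfence := image_le_of_deriv_right_lt_deriv_boundary hFc hFder (B := fun _ => Bc) (B' := fun _ => 0) hstart
    (fun _ => hasDerivAt_const _ _) (fun w hw hFw => hbound w hw hFw)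
  have hτ' : Fn τ ≤ Bc := hfence hτ
  rw [hFeq, hBc] at hτ'
  have hyτ : ‖shellVec X ((n + 1 : ℕ) : ℤ) τ‖ ^ 2 ≤ (F + η) * r ^ (n + 1) := by linarith
  calc (1 + ε₀) ^ (n + 1) * ‖shellVec X ((n + 1 : ℕ) : ℤ) τ‖ ^ 2 ≤ (1 + ε₀) ^ (n + 1) * ((F + η) * r ^ (n + 1)) :=
        mul_le_mul_of_nonneg_left hyτ (pow_nonneg hl0.le _)
    _ = (F + η) * ((1 + ε₀) ^ (n + 1) * r ^ (n + 1)) := by ring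
    _ = F + η := by rw [hPr (n + 1), mul_one]

end Summit.NavierStokesRegularity.NavierStokesRegularity.Theorems.MinimalViscousBlowup.ThresholdRay

end
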